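import Literature.AlgebraicGeometry.Frobenioids.PerfFactorialWeakGroupSaturated
import Literature.AlgebraicGeometry.Frobenioids.PiNatRealificationCofinal
import Mathlib.GroupTheory.GroupAction.Defs
import Mathlib.Algebra.Group.Subgroup.Actions
import Mathlib.Algebra.Group.Action.End
import Mathlib.Algebra.Ring.Divisibility.Basic
import HarnessLib

/-!
# `∏_J ℤ≥0`: automorphisms permute the coordinates, and the INVARIANTS under any group of automorphisms form
# again a product `∏_{J/Γ} ℤ≥0` — hence are weakly perf-factorial with `ℤ`-monoprime components and cofinal
# perfection (the shape of [EtTh] Prop. 3.4 (i)'s `Div⁺(Z^log_∞)^{Gal(Z^log_∞/Y^log)}`)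

Mochizuki, *The geometry of Frobenioids I*, Kyushu J. Math. **62** (2008), §0 p. 12 (primary elements, primes)
and Def. 2.4 (i) p. 47 [cite: MochizukiFrdI2008, Def. 2.4(i) p.47]; Mochizuki, *The étale theta function …*,
Publ. RIMS **45** (2009), Prop. 3.4 (i) PDF p. 74 ("each of the monoids `Div⁺(Z^log_∞)^{Gal(Z^log_∞/Y^log)}`
appearing in the inductive limit defining `Φ₀(Y^log)`, is perf-factorial") and Rmk. 3.3.1 p. 73 ("the set of primes
of the monoid `Div⁺(Z^log_∞)^{Gal(Z^log_∞/Y^log)}` … is in natural bijective correspondence with the set of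
`Gal(Z^log_∞/Y^log)`-orbits of prime log-divisors") [cite: MochizukiEtTh2009, Prop 3.4 p.74].

abc-iut cell, W6 cone prover abc-iut-w6-d057 (W6-TRANCHE-2 row EtTh:Prop3.4(i)), companion of
`PerfFactorialWeakGroupSaturated.lean` (p432632).  PROOF-ONLY (theorems only).  For `P = ∏_J ℤ≥0 =
Multiplicative (J → ℕ)` and ANY subgroup `Γ ≤ Aut(P)` of monoid automorphisms:

* `PiNat.exists_map_single_one`, `PiNat.coeff_map_of_map_single` — an automorphism `γ` carries each coordinate
  vector `e_j` to a coordinate vector `e_{σ j}` (`σ` a bijection), and then `(γ f)_{σ j} = f_j` for EVERY `f`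
  (divisibility by the `e_j^k` detects exponents), i.e. `Aut(∏_J ℤ≥0)` acts through permutations of `J`;
* `PiNat.exists_fixedPoints_mulEquiv` — the invariant submonoid `P^Γ` (Mathlib `FixedPoints.submonoid Γ P`) is
  `≅ ∏_{J/Γ} ℤ≥0` (functions constant on the `σ`-orbits: Rmk. 3.3.1's "primes = Galois orbits");
* `PiNat.isPerfFactorialWeak_fixedPoints`, `PiNat.isZMonoprime_submonoid_primes_fixedPoints`,
  `PiNat.rlfCofinal_fixedPoints` — hence `P^Γ` is weakly perf-factorial with `ℤ`-monoprime components and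
  cofinal perfection;
* `exists_fixedPoints_congr` — invariants transport along `P ≅ P'` (for use at `DIV⁺(Z^log_∞) ≅ ∏ ℤ≥0`).

Combined with the engine of p432632 (group-saturated perf-dense submonoids), this yields Prop. 3.4 (i) for the
Galois-invariant monoids `Div⁺(Z^log_∞)^Γ` at the `LogDivisorModel` interface (file
`EtaleTheta/Discharge/Sec3Prop34iDivPlus.lean`).  HONEST FRAMING: classical monoid algebra; the weak reading of
"perf-factorial" is the cell's (F-L2d2-1, F-L2d2-2); nothing here bears on [IUTchIII] Cor. 3.12.
-/

noncomputable section

namespace Literature.AlgebraicGeometry.Frobenioids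

open Function

universe u

/-! ### Invariants transport along isomorphisms -/

section Transport

variable {P P' : Type u} [CommMonoid P] [CommMonoid P']

/-- **Invariant submonoids transport along `P ≅ P'`**: for `Γ ≤ Aut(P)` there is `Γ' ≤ Aut(P')` (the conjugate
`e Γ e⁻¹`) with `P^Γ ≅ P'^{Γ'}` (restriction of `e`). [folklore] -/
private theorem exists_fixedPoints_congr_aux (e : P ≃* P') (Γ : Subgroup (MulAut P)) :
    ∃ Γ' : Subgroup (MulAut P'), ∀ x' : P',
      x' ∈ FixedPoints.submonoid Γ' P' ↔ e.symm x' ∈ FixedPoints.submonoid Γ P := by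
  let φ : MulAut P →* MulAut P' :=
    { toFun := fun γ => e.symm.trans (γ.trans e)
      map_one' := by ext x; simp
      map_mul' := fun γ δ => by ext x; simp [MulAut.mul_apply] }
  refine ⟨Γ.map φ, fun x' => ?_⟩
  simp only [FixedPoints.mem_submonoid]
  constructor
  · intro h ⟨γ, hγ⟩
    have h' : e (γ (e.symm x')) = x' := h ⟨φ γ, Subgroup.mem_map.mpr ⟨γ, hγ, rfl⟩⟩
    change γ (e.symm x') = e.symm x'
    simpa using congrArg e.symm h'
  · intro h ⟨γ', hγ'⟩
    obtain ⟨γ, hγ, rfl⟩ := Subgroup.mem_map.mp hγ'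
    have h' : γ (e.symm x') = e.symm x' := h ⟨γ, hγ⟩
    change e (γ (e.symm x')) = x'
    rw [h', MulEquiv.apply_symm_apply]

/-- **`P^Γ ≅ P'^{Γ'}`** for a suitable `Γ' ≤ Aut(P')`, along any `e : P ≅ P'`. [folklore] -/
private theorem exists_fixedPoints_congr' (e : P ≃* P') (Γ : Subgroup (MulAut P)) :
    ∃ Γ' : Subgroup (MulAut P'), Nonempty (↥(FixedPoints.submonoid Γ P) ≃* ↥(FixedPoints.submonoid Γ' P')) := by
  obtain ⟨Γ', hΓ'⟩ := exists_fixedPoints_congr_aux e Γ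
  refine ⟨Γ', ⟨{ toFun := fun x => ⟨e x, (hΓ' _).mpr (by simpa only [e.symm_apply_apply] using x.2)⟩,
                  invFun := fun x' => ⟨e.symm x', (hΓ' _).mp x'.2⟩,
                  left_inv := fun x => Subtype.ext (e.symm_apply_apply x.1),
                  right_inv := fun x' => Subtype.ext (e.apply_symm_apply x'.1),
                  map_mul' := fun x y => Subtype.ext (map_mul e x.1 y.1) }⟩⟩

/-- **Invariant submonoids transport along isomorphisms** (symmetric form: for `Γ' ≤ Aut(P')` there is
`Γ ≤ Aut(P)` with `P'^{Γ'} ≅ P^Γ`). [cite: MochizukiFrdI2008, §0 p.12] -/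
theorem exists_fixedPoints_congr (e : P ≃* P') (Γ' : Subgroup (MulAut P')) :
    ∃ Γ : Subgroup (MulAut P), Nonempty (↥(FixedPoints.submonoid Γ' P') ≃* ↥(FixedPoints.submonoid Γ P)) :=
  exists_fixedPoints_congr' e.symm Γ'

end Transport

namespace PiNat

variable {J : Type u}

section Coordinates

variable [DecidableEq J]

/-- `e_j^k ∣ f` iff `k ≤ f_j`. [cite: MochizukiFrdI2008, §0 p.12] -/
theorem single_dvd_iff {j : J} {k : ℕ} {f : Multiplicative (J → ℕ)} : single j k ∣ f ↔ k ≤ coeff f j := by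
  rw [dvd_iff]
  constructor
  · intro h; simpa using h j
  · intro h i
    by_cases hi : i = j
    · subst hi; simpa using h
    · rw [coeff_single_of_ne hi]; exact Nat.zero_le _

/-- **An automorphism of `∏_J ℤ≥0` carries each coordinate vector `e_j` to a coordinate vector `e_{j'}`**
(primary elements go to primary elements, and `e_j` is the least element of its prime).
[cite: MochizukiFrdI2008, §0 p.12] -/
theorem exists_map_single_one (γ : MulAut (Multiplicative (J → ℕ))) (j : J) :
    ∃ j' : J, γ (single j 1) = single j' 1 := by
  obtain ⟨j', k, hk, h⟩ := exists_eq_single_of_isPrimary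
    ((isPrimary_single j one_ne_zero).map_mulEquiv (γ : Multiplicative (J → ℕ) ≃* Multiplicative (J → ℕ)))
  obtain ⟨j'', k'', hk'', h''⟩ := exists_eq_single_of_isPrimary
    ((isPrimary_single j' one_ne_zero).map_mulEquiv (γ.symm : Multiplicative (J → ℕ) ≃* Multiplicative (J → ℕ)))
  -- `e_j = γ⁻¹(e_{j'}^k) = e_{j''}^{k k''}`
  have hback : single j 1 = single j'' (k * k'') := by
    have h1 : single j 1 = γ.symm (single j' k) := by rw [← h, MulEquiv.symm_apply_apply]
    rw [h1, show single j' k = single j' 1 ^ k by rw [single_pow, mul_one], map_pow, h'', single_pow, mul_comm]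
  have hj : j'' = j := by
    by_contra hne
    have := congrArg (fun f => coeff f j) hback
    rw [coeff_single_same, coeff_single_of_ne (Ne.symm hne)] at this
    exact one_ne_zero this
  subst hj
  have hk1 : k * k'' = 1 := by
    have := congrArg (fun f => coeff f j'') hback
    simpa using this.symm
  refine ⟨j', ?_⟩
  rw [h, Nat.eq_one_of_mul_eq_one_right hk1]

/-- **Exponents follow the permutation**: if `γ(e_j) = e_{j'}` then `(γ f)_{j'} = f_j` for every `f` (divisibility
by `e_{j'}^k` of `γ f` is divisibility by `e_j^k` of `f`). [cite: MochizukiFrdI2008, §0 p.12] -/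
theorem coeff_map_of_map_single (γ : MulAut (Multiplicative (J → ℕ))) {j j' : J}
    (h : γ (single j 1) = single j' 1) (f : Multiplicative (J → ℕ)) : coeff (γ f) j' = coeff f j := by
  have key : ∀ k, k ≤ coeff (γ f) j' ↔ k ≤ coeff f j := by
    intro k
    rw [← single_dvd_iff, ← single_dvd_iff,
      show single j' k = γ (single j k) by
        rw [show single j k = single j 1 ^ k by rw [single_pow, mul_one], map_pow, h, single_pow, mul_one]]
    exact map_dvd_iff (γ : Multiplicative (J → ℕ) ≃* Multiplicative (J → ℕ))
  exact le_antisymm ((key _).mp le_rfl) ((key _).mpr le_rfl)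

/-- The coordinate permutation of an automorphism is onto. [cite: MochizukiFrdI2008, §0 p.12] -/
theorem exists_map_single_one_eq (γ : MulAut (Multiplicative (J → ℕ))) (j' : J) :
    ∃ j : J, γ (single j 1) = single j' 1 := by
  obtain ⟨j, hj⟩ := exists_map_single_one γ.symm j'
  exact ⟨j, by rw [← hj, MulEquiv.apply_symm_apply]⟩

/-- `e_j = e_{j'}` only if `j = j'`. [cite: MochizukiFrdI2008, §0 p.12] -/
theorem single_one_injective {j j' : J} (h : single j 1 = single j' 1) : j = j' := by
  by_contra hne
  have := congrArg (fun f => coeff f j) h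
  rw [coeff_single_same, coeff_single_of_ne hne] at this
  exact one_ne_zero this

/-- **Invariants of `∏_J ℤ≥0` under `Γ ≤ Aut`**: `f` is `Γ`-invariant iff its exponents are constant along the
coordinate permutations of `Γ`. [cite: MochizukiEtTh2009, Rmk 3.3.1 p.73] -/
theorem mem_fixedPoints_iff (Γ : Subgroup (MulAut (Multiplicative (J → ℕ)))) (f : Multiplicative (J → ℕ)) :
    f ∈ FixedPoints.submonoid Γ (Multiplicative (J → ℕ)) ↔
      ∀ γ ∈ Γ, ∀ j j' : J, γ (single j 1) = single j' 1 → coeff f j' = coeff f j := by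
  simp only [FixedPoints.mem_submonoid]
  constructor
  · intro h γ hγ j j' hjj'
    have hfix : γ f = f := h ⟨γ, hγ⟩
    have := coeff_map_of_map_single γ hjj' f
    rwa [hfix] at this
  · intro h ⟨γ, hγ⟩
    change γ f = f
    refine ext fun j' => ?_
    obtain ⟨j, hj⟩ := exists_map_single_one_eq γ j'
    rw [coeff_map_of_map_single γ hj f, h γ hγ j j' hj]

/-- **`(∏_J ℤ≥0)^Γ ≅ ∏_{J/Γ} ℤ≥0`**: the invariants under any group of automorphisms form a product of copies of
`ℤ≥0` indexed by the orbits of the induced permutation action (Rmk. 3.3.1: the primes of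
`Div⁺(Z^log_∞)^{Gal}` are the Galois orbits of prime log-divisors). [cite: MochizukiEtTh2009, Rmk 3.3.1 p.73] -/
theorem exists_fixedPoints_mulEquiv (Γ : Subgroup (MulAut (Multiplicative (J → ℕ)))) :
    ∃ Q : Type u, Nonempty (↥(FixedPoints.submonoid Γ (Multiplicative (J → ℕ))) ≃* Multiplicative (Q → ℕ)) := by
  -- the orbit relation of the coordinate permutations
  let r : J → J → Prop := fun j₁ j₂ => ∃ γ ∈ Γ, γ (single j₁ 1) = single j₂ 1
  have hr : Equivalence r :=
    { refl := fun j => ⟨1, Γ.one_mem, rfl⟩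
      symm := fun {j₁ j₂} ⟨γ, hγ, h⟩ => ⟨γ⁻¹, Γ.inv_mem hγ, by
        rw [← h]; exact (γ : Multiplicative (J → ℕ) ≃* Multiplicative (J → ℕ)).symm_apply_apply _⟩
      trans := fun {j₁ j₂ j₃} ⟨γ, hγ, h⟩ ⟨δ, hδ, h'⟩ => ⟨δ * γ, Γ.mul_mem hδ hγ, by
        rw [MulAut.mul_apply, h, h']⟩ }
  let S : Setoid J := ⟨r, hr⟩
  let Q := Quotient S
  -- exponents of an invariant are constant on orbits
  have hconst : ∀ f : ↥(FixedPoints.submonoid Γ (Multiplicative (J → ℕ))), ∀ j₁ j₂, r j₁ j₂ →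
      coeff f.1 j₁ = coeff f.1 j₂ := by
    intro f j₁ j₂ ⟨γ, hγ, h⟩
    exact ((mem_fixedPoints_iff Γ f.1).mp f.2 γ hγ j₁ j₂ h).symm
  let Φ : ↥(FixedPoints.submonoid Γ (Multiplicative (J → ℕ))) →* Multiplicative (Q → ℕ) :=
    { toFun := fun f => Multiplicative.ofAdd fun q => Quotient.liftOn' q (fun j => coeff f.1 j) (hconst f)
      map_one' := by
        apply Multiplicative.toAdd.injective; funext q
        induction q using Quotient.inductionOn' with
        | h j => rfl
      map_mul' := fun f g => by
        apply Multiplicative.toAdd.injective; funext q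
        induction q using Quotient.inductionOn' with
        | h j => rfl }
  refine ⟨Q, ⟨MulEquiv.ofBijective Φ ⟨fun f g h => ?_, fun g => ?_⟩⟩⟩
  · -- injective: exponents determine the element
    apply Subtype.ext; refine ext fun j => ?_
    exact congrArg (fun x : Multiplicative (Q → ℕ) => (Multiplicative.toAdd x) (Quotient.mk'' j : Q)) h
  · -- surjective: a function on orbits gives an invariant
    let f : Multiplicative (J → ℕ) := Multiplicative.ofAdd fun j => Multiplicative.toAdd g (Quotient.mk'' j : Q)
    have hf : f ∈ FixedPoints.submonoid Γ (Multiplicative (J → ℕ)) := by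
      rw [mem_fixedPoints_iff]
      intro γ hγ j j' h
      have hq : (Quotient.mk'' j : Q) = Quotient.mk'' j' := Quotient.sound' ⟨γ, hγ, h⟩
      show Multiplicative.toAdd g (Quotient.mk'' j' : Q) = Multiplicative.toAdd g (Quotient.mk'' j : Q)
      rw [hq]
    refine ⟨⟨f, hf⟩, ?_⟩
    apply Multiplicative.toAdd.injective; funext q
    induction q using Quotient.inductionOn' with
    | h j => rfl

end Coordinates

/-! ### Consequences: `(∏_J ℤ≥0)^Γ` is weakly perf-factorial, `ℤ`-monoprime components, cofinal perfection -/

/-- **`(∏_J ℤ≥0)^Γ` is weakly perf-factorial** for every `Γ ≤ Aut(∏_J ℤ≥0)`. [cite: MochizukiEtTh2009, Prop 3.4 p.74] -/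
theorem isPerfFactorialWeak_fixedPoints (Γ : Subgroup (MulAut (Multiplicative (J → ℕ)))) :
    IsPerfFactorialWeak ↥(FixedPoints.submonoid Γ (Multiplicative (J → ℕ))) := by
  classical
  obtain ⟨Q, ⟨e⟩⟩ := exists_fixedPoints_mulEquiv Γ
  exact (isPerfFactorialWeak' (J := Q)).of_mulEquiv e.symm

/-- **The prime components of `(∏_J ℤ≥0)^Γ` are `ℤ`-monoprime** (`≅ ℤ≥0`, one per orbit).
[cite: MochizukiEtTh2009, Rmk 3.3.1 p.73] -/
theorem isZMonoprime_submonoid_primes_fixedPoints (Γ : Subgroup (MulAut (Multiplicative (J → ℕ))))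
    (𝔭 : Primes ↥(FixedPoints.submonoid Γ (Multiplicative (J → ℕ)))) : IsZMonoprime ↥𝔭.submonoid := by
  classical
  obtain ⟨Q, ⟨e⟩⟩ := exists_fixedPoints_mulEquiv Γ
  exact (isZMonoprime_submonoid_prime (Primes.congr e 𝔭)).of_mulEquiv
    (Primes.submonoidCongr e.symm (Primes.congr e 𝔭) 𝔭 (Primes.congr_symm_apply_congr e 𝔭))

/-- **(d_cof) for `(∏_J ℤ≥0)^Γ`**: its perfection is cofinal in its realification.
[cite: MochizukiEtTh2009, Lem 3.5 p.75] -/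
theorem rlfCofinal_fixedPoints (Γ : Subgroup (MulAut (Multiplicative (J → ℕ)))) :
    ∀ x : (isPerfFactorialWeak_fixedPoints Γ).Rlf, ∃ b, x ∣ (isPerfFactorialWeak_fixedPoints Γ).toRealification b := by
  classical
  obtain ⟨Q, ⟨e⟩⟩ := exists_fixedPoints_mulEquiv Γ
  exact IsPerfFactorialWeak.rlfCofinal_of_mulEquiv e.symm (isPerfFactorialWeak' (J := Q))
    (rlf_cofinal' (J := Q)) (isPerfFactorialWeak_fixedPoints Γ)

end PiNat

end Literature.AlgebraicGeometry.Frobenioids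

end
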